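import Mathlib
import HarnessLib
import HarnessLib.Audit
import Summits.HodgeConjecture.Statement
import Literature.AlgebraicGeometry.Motives.AbelianVariety
import Literature.AlgebraicGeometry.Motives.FamiliesVHS
import Literature.AlgebraicGeometry.HodgeTheory.WeilClasses
import Literature.AlgebraicGeometry.HodgeTheory.GysinFormalism

/-!
Route: RankFourFaces

# Route RankFourFaces — the CM sector lives in E-rank four — faces of the CM relation lattice reduce
every CM Hodge class to codimension-two Weil classes, reached by transport in the split rank-4
unitary family

RESURRECT-2001 (lens): the upheld-but-unfinished wall `summits/hodge-w-supersingular-lifting` of the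
2001 programme (route `rank-four-weil-generation`,
STATUS upheld; free seat `hodge-w-rank-four-weil-faces/y1`, 32 statements left sorried) proved a
LATTICE THEOREM: for a CM field E of degree 2g
the lattice R_g of balanced multiplicity functions on the CM types of E (the exponents m for which
André's E-line L_m = ⋀^{|m|}_E H¹(∏ A_a^{m(a)}) ⊂ H^{|m|}
is Hodge) is generated by PAIRS (|m| = 2, divisor classes) and FACES q(a;i,j) = e_a + e_{-a^(i)} +
e_{-a^(j)} + e_{a^(ij)} (|m| = 4), with a non-negative
decomposition m + u = v (stockroom
`reserve/prior-2001/Prior/HodgeConjecture/HodgeConjecture/Hodge_WSupersingularLiftingRankFourWeilGeneration_RankFourWeilLattice.lean`,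
`theoremA`, `exists_nonneg_decomposition`, `algebraic_of_faces`, kernel-checked). Combined with
André's theorem (every Hodge class on a CM abelian variety is a
sum of pull-backs of split E-Weil classes ⋀^{2k}_E, CharlesSchnell2014Notes Thm 11.5.21 =
Andre1992HodgeCM) and the closure of algebraic classes under
exterior product / projection formula / Lefschetz (1,1), the WHOLE CM SECTOR of the Hodge conjecture
collapses to E-RANK FOUR: the generalized Weil classes
W_E = ⋀⁴_E H¹(Q) ⊂ H⁴(Q, ℚ) (Moonen–Zarhin) of the 4g-dimensional "face" varieties Q = A_a ×
A_{-a^(i)} × A_{-a^(j)} × A_{a^(ij)} — CODIMENSION TWO,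
whatever g. Faces are of SPLIT Weil type (Thm 11.5.22), so each lies in Deligne's connected split
rank-4 unitary family (Thm 11.5.24) through a ℚ-split
point A₀ ⊗_ℚ E whose E-Weil classes are pull-backs of the point class of the abelian surface A₀ —
algebraic for free. It therefore suffices to show
X = RankFourWeilTransport: Grothendieck's variational Hodge statement for DEGREE-FOUR classes on
smooth projective families of abelian 4g-folds with
E-multiplication (E = ℚ[T]/(P) CM of degree 2g ≥ 4), from one algebraic fibre to all fibres.
FaceReduction (X ⇒ HC for every CM abelian variety, the
shared target CMAbelianHodge), CMToAbelian (CM ⇒ all abelian varieties, transport from the dense CM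
points of Mumford–Tate families) and the declared
complement AbelianComplement (rev 1, ground repair 2026-08-16: the Hodge conjecture for every smooth
projective n-fold that is NOT the underlying variety of an n-dimensional abelian variety —
COMPLEMENT form, restated from the conditional `HC for abelian varieties → HodgeConjecture` shared
verbatim with ConservativityLefschetz at rev 0, so that the Assembly is a genuine case split and not
a propositional tautology; CLAIMED here as last crux) carry X to the Statement.
What changed from 2001: the attack on faces (there: supersingular p-adic lifting = today's
SupersingularIsotypicLift lever, and theta/adelic isolation,
both unfinished) is replaced by transport at rank four from Deligne's free anchors, and the target
is re-typed on the tree's real carriers.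
Lean: `∀ (g : ℕ), 2 ≤ g → ∀ (P : Polynomial ℤ), P.Monic → P.natDegree = 2 * g → Irreducible (P.map
(Int.castRingHom ℚ)) → (∀ ρ : ℂ, Polynomial.eval₂ (Int.castRingHom ℂ) ρ P = 0 → ρ.im ≠ 0) → (∃ Q :
Polynomial ℚ, ∀ ρ : ℂ, Polynomial.eval₂ (Int.castRingHom ℂ) ρ P = 0 → Polynomial.aeval ρ Q =
(starRingEnd ℂ) ρ) → ∀ ⦃𝒳 S : Literature.AlgebraicGeometry.Motives.SchemeOver ℂ⦄ (f : 𝒳 ⟶ S),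
Literature.AlgebraicGeometry.Motives.IsSmoothProjectiveFamily f (4 * g) → IrreducibleSpace S.left →
AlgebraicGeometry.Smooth S.hom → (∀ s : Literature.AlgebraicGeometry.Motives.ComplexPoints S, ∃ (A'
: Literature.AlgebraicGeometry.Motives.AbelianVariety ℂ) (φ' : A' ⟶ A'), A'.dim = 4 * g ∧
Polynomial.eval₂ (Int.castRingHom (CategoryTheory.End A')) (φ' : CategoryTheory.End A') P = 0 ∧
Nonempty (A'.X ≅ Literature.AlgebraicGeometry.Motives.fiberOver f s)) → ∀ (W :
Literature.AlgebraicGeometry.HodgeTheory.complexBetti 𝒳 4), (∀ s :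
Literature.AlgebraicGeometry.Motives.ComplexPoints S,
Literature.AlgebraicGeometry.HodgeTheory.IsRationalClass
(Literature.AlgebraicGeometry.HodgeTheory.complexBetti.map
(Literature.AlgebraicGeometry.Motives.fiberι f s) 4 W) ∧
Literature.AlgebraicGeometry.HodgeTheory.IsOfHodgeType (4 * g)
(Literature.AlgebraicGeometry.Motives.fiberOver f s) 4 2 2
(Literature.AlgebraicGeometry.HodgeTheory.complexBetti.map
(Literature.AlgebraicGeometry.Motives.fiberι f s) 4 W)) → (∃ s₀ :
Literature.AlgebraicGeometry.Motives.ComplexPoints S,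
Literature.AlgebraicGeometry.HodgeTheory.complexBetti.map
(Literature.AlgebraicGeometry.Motives.fiberι f s₀) 4 W ∈
Literature.AlgebraicGeometry.HodgeTheory.algebraicClasses
(Literature.AlgebraicGeometry.Motives.fiberOver f s₀) 2) → ∀ s :
Literature.AlgebraicGeometry.Motives.ComplexPoints S,
Literature.AlgebraicGeometry.HodgeTheory.complexBetti.map
(Literature.AlgebraicGeometry.Motives.fiberι f s) 4 W ∈
Literature.AlgebraicGeometry.HodgeTheory.algebraicClasses
(Literature.AlgebraicGeometry.Motives.fiberOver f s) 2`

## Assembly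
A case split (sorry-free in the planner's Sketch.lean, lean check rc 0; the deciding theorem
`closes` in glue.lean uses every crux): for a smooth projective
n-fold X, either X = A.X for a complex abelian variety A with A.dim = n — then FaceReduction turns
RankFourWeilTransport into CMAbelianHodge and CMToAbelian turns
that into `HodgeConjectureFor A.dim A.X` (the smooth-projectivity witness is X's own) — or no such A
exists and AbelianComplement (complement form) gives
`HodgeConjectureFor n X`. Rev 0 typed AbelianComplement conditionally (`(∀ A, IsSmoothProjective
A.dim A.X → HodgeConjectureFor A.dim A.X) → HodgeConjecture`),
which made the Assembly item modus ponens ×3, flagged `ground.trivial (tauto)` by the ground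
battery; rev 1 (route-repair, 2026-08-16) excludes the abelian
locus in the hypothesis of AbelianComplement instead (same typing pattern as
PadicSemiregularLift.HodgeBeyondAnchors) and `closes` does the case split. The anti-vacuity conjunct
`Nonempty (HodgeModel n X)` of `HodgeConjectureFor` travels inside the hypotheses (CMAbelianHodge
and the
abelian statement conclude `HodgeConjectureFor`, which carries it), so no separate HodgeModels item
is needed.

Rationale: WHY THIS LINE. André reduces CM Hodge classes to split E-Weil classes of every E-rank 2k
(Andre1992HodgeCM; CharlesSchnell2014Notes 11.5.21; Markman2025SurveySecant Thm 1.4), and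
the only algebraicity theorem for Weil classes, Markman's secant-sheaf theorem, lives in E-rank 4
over IMAGINARY QUADRATIC E = abelian fourfolds of Weil type,
all discriminants (Markman2025SecantWeil; arXiv:2509.23403 Thm 1.1, Cor 1.3), while "Weil classes
for CM-fields K with [K:ℚ] > 2" is the question Markman
leaves open (arXiv:2509.23403 §12) and the one the tree parks three times
(HeckePrymWeil/HeckeOrbitCompactness SummitOffWeilSector glosses; PadicSemiregularLift
crux HodgeAbelianVarieties, stub_weilSectorSuffices). The 2001 lattice theorem is the missing
bridge: it bounds the E-RANK André needs by four, so the CM sector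
becomes a codimension-two problem on 4g-folds, exactly the rank at which Markman's general-CM-field
strategy starts (Y × Ŷ, Y a 2g-fold with real multiplication
by E⁺, arXiv:2509.23403 §§4–5) and at which Chern classes c₂ of reflexive sheaves, Abel–Jacobi /
normal-function methods and Bloch semiregularity of
codimension-2 cycles have traction. Imported: combinatorics of CM types (the 2001 sign-vector
lattice), Deligne's split-Weil family argument (anchors for free:
Deligne1982HodgeCycles Thm 4.8, CharlesSchnell2014Notes 11.5.23–24), Moonen–Zarhin's W_F formalism
(MoonenZarhin1998WeilClasses). What no existing route does:
HeckePrymWeil / HeckeOrbitCompactness / NodalThetaWeil fix E imaginary quadratic and climb in RANK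
2n; this line fixes the rank at 4 and ranges over ALL CM fields —
the orthogonal normal form — and discharges anchor existence in its sector by a theorem instead of a
crux (compare AnchorTransport's AnchorExistence).

RANKED CRUXES. #0 CMAbelianHodge (target) — the Hodge conjecture for complex abelian varieties of CM
type (End⁰(A) ⊇ a commutative reduced ℚ-subalgebra of dimension 2 dim A) — verbatim the decl
`SupersingularIsotypicLift.CMAbelianHodge` (shared item); by Pohlmann/Milne it implies the Tate
conjecture for all abelian varieties over finite fields. (why it might fail: it contains Weil's 1977
candidate counterexamples at CM points and the biquadratic E-Weil classes no quadratic sector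
reaches; no cycle construction is known for any CM field of degree > 2; HC may simply fail here.)
[Pohlmann1968, Milne1999, vanGeemen1994HodgeAV, Andre1992HodgeCM, arXiv:2509.23403]
#2 RankFourWeilTransport (crux) — variational Hodge for DEGREE-FOUR classes on smooth projective
families f : 𝒳 → S (S smooth irreducible) all of whose fibres are abelian 4g-folds (g ≥ 2) carrying
an endomorphism φ with P(φ) = 0, P a fixed monic integer polynomial of degree 2g, irreducible over
ℚ, without real roots and with polynomial complex conjugation (E = ℚ[T]/(P) a CM field acting with
E-rank 4): a global class W ∈ H⁴(𝒳(ℂ);ℂ) whose fibre restrictions are rational of type (2,2) and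
algebraic on ONE fibre is algebraic on EVERY fibre. The sector instance (degree 4 on 4g-folds, never
the middle degree) of AnchorTransport.VariationalHodge; its intended engines: Markman-type
semiregular secant objects on Y × Ŷ for Y with real multiplication by E⁺ (arXiv:2509.23403 §§4–5,
§12) deformed over the Hodge locus (Buchweitz–Flenner/Pridham), or p-adic/motivic transport at the
ℚ̄-rational CM face points. [difficulty: open-problem] (why it might fail: it is variational Hodge
in codimension 2 on abelian schemes of relative dimension ≥ 8 — open beyond divisors; Markman's
sheaf engine needs RM secant objects nobody has built (2509.23403 §12) and the 2001 counterexample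
to his Question 11.4 (semiregular-propagation v7) kills first-order criteria.) [arXiv:2509.23403,
Markman2025SecantWeil, CharlesSchnell2014Notes, Deligne1982HodgeCycles, BuchweitzFlenner2003]
#3 FaceReduction (crux) — rank-four transport already gives the whole CM sector:
RankFourWeilTransport → CMAbelianHodge. Proof plan (print + stockroom): (i) André's decomposition
over a Galois CM field E ∋ √-d splitting A (CharlesSchnell2014Notes 11.5.21) writes every Hodge
class on A ⊗_ℚ E ~ ∏ A_a^{m(a)} as a sum of pull-backs of the E-lines L_m, m balanced; (ii) the 2001
lattice theorem (adapt
`reserve/prior-2001/Prior/HodgeConjecture/HodgeConjecture/Hodge_WSupersingularLiftingRankFourWeilGeneration_RankFourWeilLattice.lean`: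
`theoremA`, `exists_nonneg_decomposition`, `algebraic_of_faces`) reduces all L_m to pairs (Lefschetz
(1,1)) and faces, using exterior products (h_mul) and the cancellation L_{m+u}, L_u algebraic ⇒ L_m
algebraic (h_cancel: project (x ⊗ y) ∪ pr₂^*(ȳ θ^r) to A_m; the θ-power pairs each σ-line of L_u
non-trivially); (iii) faces are of split Weil type (11.5.22), so Deligne's family (11.5.24, neat
level, det-1 monodromy, global invariant cycles) joins each face to a Hecke translate of A₀ ⊗_ℚ E,
A₀ an abelian surface, where W_E = pull-backs of the point class of A₀ along homomorphisms A₀^{2g} →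
A₀ (Vandermonde/polarisation of the 4-form) is algebraic; (iv) RankFourWeilTransport carries
algebraicity to the face. [deps: RankFourWeilTransport] [difficulty: L] (why it might fail: the
typed transport wants ONE smooth irreducible base, smooth projective total space, fibres ≅ (A′, φ′)
with P(φ′)=0 and a GLOBAL degree-4 class through face and anchor (neat level, det-1 cover, invariant
cycles on a non-proper total space); h_cancel's θ-pairing must hit every σ-line.) [Andre1992HodgeCM,
CharlesSchnell2014Notes, Deligne1982HodgeCycles, MoonenZarhin1998WeilClasses, vanGeemen1994HodgeAV]
#4 CMToAbelian (crux) — the Hodge conjecture for CM abelian varieties implies the Hodge conjecture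
for every complex abelian variety: every (A, its Hodge classes) sits in its Mumford–Tate family,
whose CM points are dense (Deligne/André) and where the flat extensions of the Hodge classes of A
stay Hodge; transport algebraicity from a CM fibre (variational Hodge for abelian schemes, all
codimensions — the abelian instance of AnchorTransport.VariationalHodge with AnchorExistence
discharged by CM density). [deps: FaceReduction] [difficulty: open-problem] (why it might fail:
needs variational Hodge in every codimension along Mumford–Tate families of abelian varieties — open
beyond divisors; HC could fail at a Hodge-generic abelian variety while holding at all CM points
(absoluteness cannot tell them apart).) [Deligne1982HodgeCycles, Andre1996Motifs,
CharlesSchnell2014Notes, arXiv:2509.23403]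
#9 AbelianComplement (crux) — the remainder of the summit in COMPLEMENT form (rev 1, route-repair
2026-08-16): the Hodge conjecture for every smooth projective complex n-fold X that is NOT the
underlying variety A.X of an n-dimensional complex abelian variety A (X carries no abelian-variety
structure; the clause A.dim = n is automatic for X smooth projective of dimension n and is carried
only to keep that discharge out of the import cone — the typing pattern of
PadicSemiregularLift.HodgeBeyondAnchors without its Fermat exclusion). Rev 0 used verbatim the
conditional shared decl `ConservativityLefschetz.AbelianComplement` (`HC for all abelian varieties →
HodgeConjecture`); with FaceReduction and CMToAbelian themselves implications this made the Assembly
item a propositional tautology (ground battery: ground.trivial tauto), so the abelian locus is now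
excluded in the hypothesis and `closes` does the case split. NOT the route's mechanism — CLAIMED as
last crux only so that `closes` spans the Statement (as HeckePrymWeil/HeckeOrbitCompactness do with
SummitOffWeilSector): it is HC for every non-abelian smooth projective variety (Kuga–Satake-type
transfers aside, no reduction to abelian varieties is known). Conjecture-grade; its negation is a
clean negative-side target (one non-algebraic Hodge class on a non-abelian X refutes it and the Clay
statement); closes by name from any proof of HodgeConjecture; it implies the rev-0 conditional form
outright. Do not staff. [deps: CMToAbelian] [difficulty: open-problem] (why it might fail: it is HC
for everything of non-abelian type (general hypersurfaces, Calabi–Yau, surfaces of general type): HC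
fails for Kähler manifolds (Voisin 2002) and integrally, so it may be false here, and the route's
mechanism does not bear on it.) [Voisin2002KaehlerCounterexample, Deligne2000, Andre1996Motifs,
CharlesSchnell2014Notes]
#9 RankFourWeilClasses (support) — the POINTWISE form the transport delivers on every split
component and the tree's first typed statement of "Weil classes for CM fields of degree > 2": for
(A, φ) an abelian 4g-fold with P(φ) = 0 (P as in crux 2, E = ℚ[T]/(P) CM of degree 2g ≥ 4, E-rank
4), every rational (2,2)-class in the complexified E-Weil space (⋀⁴_E H¹(A,ℚ)) ⊗ ℂ = ⨆_{P(ρ)=0} {c :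
(x·𝟙 + y·φ)^*c = (x + yρ)⁴ c ∀ x y ∈ ℕ} (Moonen–Zarhin W_E with r = 4, on the tree's
`pullbackEigenclasses` carrier) is algebraic. For E imaginary quadratic (excluded: g ≥ 2) it is
Markman's fourfold theorem; stated for all discriminant classes (implied by HC; for non-split
classes no anchor is known and the reduction does not need them). A refutation refutes
CMAbelianHodge at a face, or HC off the CM points. [difficulty: open-problem]
[MoonenZarhin1998WeilClasses, arXiv:2509.23403, Markman2025SecantWeil, Weil1977HodgeRing]

TWO-LAYER PLAN. Foreseen glued splits (nothing filed now): FaceReduction ⇐ LatticeFaces (adapt the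
2001 RankFourWeilLattice file over a geometric `Alg` predicate: provable-now) →
SplitFamilyThroughFaces (11.5.22 + 11.5.24 + ℚ-split anchor algebraicity + global class) →
FaceReduction; RankFourWeilTransport ⇐ RMSecantSeeds (a Buchweitz–Flenner-
semiregular secant object on Y × Ŷ, Y a 2g-fold with real multiplication by E⁺ = ℚ[T]/(P)⁺, whose
Chern character reaches the E-Weil line — Markman's §12 question,
answered at rank 4) → SemiregularSpread (deformation over the Hodge locus = the whole rank-4 family;
isogeny/Baire closing) → RankFourWeilTransport; CMToAbelian ⇐
MumfordTateCMAnchors (CM density + flat Hodge extension) → AbelianSchemeVHC → CMToAbelian. First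
calibration rung for provers: g = 3, E = ℚ(ζ₇) or ℚ(ζ₉), the face
12-folds built from J(y² = x⁷ − 1)-type CM threefolds (are these faces already algebraic by Shioda's
Fermat-type results? — a support to file when checked).

KILL CRITERIA. A non-algebraic rank-4 E-Weil Hodge class at a CM face point (¬RankFourWeilClasses
there) refutes CMAbelianHodge and the Clay statement — close `refuted:CMAbelianHodge`
and hand the witness to the negative side; a family violating RankFourWeilTransport is ¬VHC hence
¬HC likewise. FaceReduction refuted-MISSTATED (family / level /
global-class bookkeeping) ⇒ repair by restating with the corrected family hypotheses (the lattice
part is kernel-checked and cannot be the cause). CMAbelianHodge proved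
elsewhere (SupersingularIsotypicLift, PadicSemiregularLift.HodgeAbelianVarieties) moots cruxes 2–3;
HC for abelian varieties proved moots 2–4; the route is then its complement only. A non-algebraic
Hodge class on any NON-abelian smooth projective X refutes AbelianComplement (complement form, rev
1) and the Clay statement without touching cruxes 2–4 — close `refuted:AbelianComplement`, the
summit is then decided negatively.

NOT DECOMPOSED YET. The Shimura/PEL family construction inside FaceReduction (neat level, universal
abelian scheme, det-1 cover, global invariant cycles) and the geometric dictionary
(h_pair, h_mul, h_cancel on real carriers) — layer-2 children; the engine of RankFourWeilTransport
(sheaf-theoretic vs p-adic) — deliberately black-box at open; the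
quartic case g = 2, where faces are sums of pairs (q(++;1,2) = p(++) + p(+−)) and the reduction
needs no transport, is recorded, not filed; non-split rank-4
discriminant classes (no anchors known; not needed by André) are stated only inside the support
RankFourWeilClasses.

CHEAPEST FALSIFIER. (run by hand, 2026-08-16) rank count: rk R_g = 2^g − g, pairs span 2^(g−1), so
faces are genuinely needed from g = 3 (5 > 4) and are pair-sums at g = 2 — consistent with
HC known for products of CM surfaces and CM elliptic curves; the lattice theorem itself is
kernel-checked (stockroom build GREEN 2026-08-14). For refuters, the two
lookups that would downgrade the route: (a) is "HC for CM abelian varieties reduces to ⋀⁴_E-Weil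
classes" already in print (Milne1999 / Milne1999LefschetzClasses,
Murty's 2000 Banff survey zbl:1028.14016, MoonenZarhin1998WeilClasses — none states it; MZ only
relate W_F ⊂ ⟨exterior products of W_F'⟩ for F ⊂ F', the opposite
direction)? (b) is the first contentful face — E = ℚ(ζ₇), the ⋀⁴_E-line in H⁴ of J(y²=x⁷−1) × three
anti-neighbour CM twists (a 12-fold of Fermat type) —
already algebraic by Shioda 1979/1982 (prime level 7), or already a recorded OPEN exceptional class?
Either answer sharpens crux 2's first rung; neither kills the line.

NUMBERS. E CM of degree 2g, g ≥ 2; face variety dimension 4g, classes in H⁴ (codimension 2), dim_ℚ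
W_E = 2g; split rank-4 unitary family: hermitian symmetric domain
∏_σ U(2,2), complex dimension 4g; rk R_g = 2^g − g (g sign-sum functionals on ℤ^(2^g)), pairs span
2^(g−1), faces add 2^(g−1) − g; first contentful case g = 3:
12-folds, 6-dimensional ℚ-space of Weil classes, 12-dimensional family. Known: rank 4 over imaginary
quadratic E = Weil fourfolds, ALL discriminants
(Markman2025SecantWeil; arXiv:2509.23403 Thm 1.1) ⇒ HC for abelian varieties of dimension ≤ 5 (Cor
1.3); split sixfolds for imaginary quadratic E
(arXiv:2502.03415); CM fields of degree > 2: nothing (arXiv:2509.23403 §12). Items at open: 7 (4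
cruxes, 1 target, 1 support, 1 assembly); rev 1 (ground repair) restated AbelianComplement in
complement form, count unchanged.

DEFINITION REQUESTS. None needed for the typed layer (all statements are over
Literature.AlgebraicGeometry.Motives.AbelianVariety / FamiliesVHS and HodgeTheory.WeilClasses /
GysinFormalism real carriers; `CategoryTheory.End A` carries the Preadditive ring structure used for
P(φ) = 0). Cite facts wanted (to be filed `--kind cite` after
open): Andre1992HodgeCM in the Charles–Schnell 11.5.21 form ("every Hodge class on a CM abelian
variety split by a Galois CM field E is a sum of pull-backs of classes
in ⋀^(2k)_E H¹ of products of CM abelian varieties of E-types with constant sum"); Deligne's split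
family 11.5.24; the 2001 lattice theorem is NOT a Literature fact —
it is re-proved in Theorems by adapting the stockroom file (support of FaceReduction).

Novelty: Searches (2026-08-16): `lit search --hybrid "André cycles de Hodge type CM Weil classes abelian
varieties sum of products pullbacks"` (12; CharlesSchnell2014Notes pp. 509–516 READ:
11.5.18–11.5.24);
`lit read arxiv:2509.23403 --grep "CM.field|rank 4|§12"` (READ Thm 1.4 = André, §1.2, §12: degree >
2 open); `lit read arxiv:alg-geom/9612017` (MoonenZarhin1998WeilClasses READ: W_F = ⋀^r_F,
F ⊂ F' remark); `lit search --source zbmath "Hodge cycles CM abelian varieties Weil classes"` (5: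
MZ1998, Murty 2000 survey, Lang CM, Kisin–Zhou); remote OpenAlex/S2/arXiv
rate-limited this session (429) — logged; tree:
`Cruxes/SummitOffWeilSector/Ideas/weil-induction-anchors.md` (induction B ↦ B ⊗_K E, SAME
free-anchor observation, triage-failed
on scope), `Cruxes/HodgeAbelianVarieties/Lines/*` (all imaginary-quadratic sixfold seeds),
KillTransfer.lean hub; stockroom `lean find` of RankFourWeilLattice (2001, upheld, unpublished).
Nearest prior art found: Andre1992HodgeCM = CharlesSchnell2014Notes Thm 11.5.21 (reduction to split
E-Weil classes of EVERY rank 2k); Deligne1982HodgeCycles Thm 4.8 / CS 11.5.24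
(the ℚ-split anchors and the connected split family — used verbatim, not claimed);
MoonenZarhin1998WeilClasses (W_F formalism, norm relation in the FIELD direction); Markman
arXiv:2509.23403 (rank 4 and 6 over imaginary quadratic E; general-CM-field strategy announced, §12
open); in-tree weil-induction-anchors card (induction anchors, no rank bound).
Delta: the RANK bound — by the 2001 face t  [refs: 2509.23403, alg-geom/9612017, arxiv:2509.23403, arxiv:alg-geom/9612017]

Barriers (technique_class: weil-classes, cm-fields, variational-hodge, anchors): - technique_class: weil-classes, cm-fields, variational-hodge, anchors
- Literature.Barriers.HodgeConjecture.Weil1977_exceptionalHodgeClasses: the line never claims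
divisorial generation — its generators are pairs (divisors) AND faces (exceptional rank-4 E-Weil
classes); the reduction bounds the RANK of the exceptional generators, not their existence, and the
generic point of the rank-4 family keeps B¹ small exactly as Weil's theorem demands.
- Literature.Barriers.HodgeConjecture.Mumford1968_simpleFourfold_exceptionalHodgeClasses: same
evasion; Mumford–Pohlmann's CM fourfold classes are rank-4 Weil classes over imaginary quadratic
subfields (Moonen–Zarhin), i.e. Markman's solved case, below the route's g ≥ 2.
- Literature.Barriers.HodgeConjecture.Voisin2002_weilTorus_hodgeClassWithoutSubvarieties: transport
runs only along the POLARISED (algebraic, Shimura) rank-4 family and through projective fibres; no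
step is Kähler-intrinsic, as in Markman's evasion — conceded that any engine for crux 2 must use the
polarisation.
- Literature.Barriers.HodgeConjecture.Andre1996_hodgeClassesOnAbelianVarieties_motivated: consistent
and used only as orientation (the classes transported are motivated/absolute, so the Hodge locus of
W is the whole base); the route does not assume B.
- Literature.Barriers.HodgeConjecture.hodgeClassesAreAbsoluteFor_abelianVariety: not triggered —
Deligne's theorem makes every class in play absolute Hodge; absoluteness is what makes the family in
FaceReduction alg

History (route lifecycle, newest last):
- 2026-08-16T16:51:37Z · rev 2: restated AbelianComplement (stmt-HodgeConjecture-10452) — route-repair (ground-failed) step 2/3: restate AbelianComplement — the only ground failure was the Assembly item (stmt-HodgeConjecture-16269, ground.trivial tau (planner-rground-HodgeConjecture-RankFourFaces-3a855859-0)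

sub-problem: HodgeConjecture · status: open · opened planner-plan-lens-HodgeConjecture-resurrect2001-v2-g2-0 2026-08-16T16:29:49Z · rev 5 · ledger route-HodgeConjecture-RankFourFaces
GENERATED by the gate from the ledger (D-0016/17). Provers cite these decls: `theorem foo : Summit.HodgeConjecture.HodgeConjecture.Theses.RankFourFaces.<Decl> := …` in Summits/HodgeConjecture/HodgeConjecture/Theorems/<Name>.lean.
-/

namespace Summit.HodgeConjecture.HodgeConjecture.Theses.RankFourFaces

open scoped BigOperators Topology Manifold Classical MeasureTheory ProbabilityTheory Matrix InnerProductSpace ComplexConjugate ContinuousMap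
open Filter Set Function TopologicalSpace MeasureTheory

attribute [summit_statement] _root_.HodgeConjecture

/-- item stmt-HodgeConjecture-3052 · target · rank 0 · open · by planner
why it might fail: it contains Weil's 1977 candidate counterexamples at CM points and the biquadratic E-Weil classes no quadratic sector reaches; no cycle construction is known for any CM field of degree > 2; HC may simply fail here.
sources: Pohlmann1968, Milne1999, vanGeemen1994HodgeAV, Andre1992HodgeCM, arXiv:2509.23403
[support] MILESTONE: the Hodge conjecture for complex abelian varieties of CM type (End⁰(A) ⊇ a
commutative reduced ℚ-subalgebra of dimension 2 dim A; smooth-projectivity quantified as a witness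
as in the barrier files). Open in general (Pohlmann1968: equivalent to the Tate conjecture for A;
Milne1999: implies Tate for all abelian varieties over finite fields; known for nondegenerate CM
types, prime dimension, special Weil-type examples — vanGeemen1994HodgeAV §4). In this route it is
LIFT ∧ ENV on the CM family: ENV holds by CM idempotents (Pohlmann1968), LIFT is to come from ALG
via primes of supersingular reduction (Frobenius = complex conjugation in the reflex closure;
positive density, unramified, p > g + 6) where A₁ ~ E^g and H^{2p} is spanned by products of
divisors. Sources: Pohlmann1968, Milne1999, Deligne1982HodgeCycles, vanGeemen1994HodgeAV. -/
@[route_item "route-HodgeConjecture-RankFourFaces"]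
def CMAbelianHodge : Prop :=
  ∀ (A : Literature.AlgebraicGeometry.Motives.AbelianVariety ℂ), Literature.AlgebraicGeometry.Motives.IsSmoothProjective A.dim A.X → (∃ S : Subalgebra ℚ A.endAlgebra, IsReduced ↥S ∧ (∀ x ∈ S, ∀ y ∈ S, x * y = y * x) ∧ Module.finrank ℚ ↥S = 2 * A.dim) → Literature.AlgebraicGeometry.HodgeTheory.HodgeConjectureFor A.dim A.X

/-- item stmt-HodgeConjecture-16265 · crux · rank 2 · open · by planner
why it might fail: it is variational Hodge in codimension 2 on abelian schemes of relative dimension ≥ 8 — open beyond divisors; Markman's sheaf engine needs RM secant objects nobody has built (2509.23403 §12) and the 2001 counterexample to his Question 11.4 (semiregular-propagation v7) kills first-order criteria.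
sources: arXiv:2509.23403, Markman2025SecantWeil, CharlesSchnell2014Notes, Deligne1982HodgeCycles, BuchweitzFlenner2003
[crux] variational Hodge for DEGREE-FOUR classes on smooth projective families f : 𝒳 → S (S smooth
irreducible) all of whose fibres are abelian 4g-folds (g ≥ 2) carrying an endomorphism φ with P(φ) =
0, P a fixed monic integer polynomial of degree 2g, irreducible over ℚ, without real roots and with
polynomial complex conjugation (E = ℚ[T]/(P) a CM field acting with E-rank 4): a global class W ∈
H⁴(𝒳(ℂ);ℂ) whose fibre restrictions are rational of type (2,2) and algebraic on ONE fibre is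
algebraic on EVERY fibre. The sector instance (degree 4 on 4g-folds, never the middle degree) of
AnchorTransport.VariationalHodge; its intended engines: Markman-type semiregular secant objects on Y
× Ŷ for Y with real multiplication by E⁺ (arXiv:2509.23403 §§4–5, §12) deformed over the Hodge locus
(Buchweitz–Flenner/Pridham), or p-adic/motivic transport at the ℚ̄-rational CM face points.
[difficulty: open-problem] -/
@[route_item "route-HodgeConjecture-RankFourFaces"]
def RankFourWeilTransport : Prop :=
  ∀ (g : ℕ), 2 ≤ g → ∀ (P : Polynomial ℤ), P.Monic → P.natDegree = 2 * g → Irreducible (P.map (Int.castRingHom ℚ)) → (∀ ρ : ℂ, Polynomial.eval₂ (Int.castRingHom ℂ) ρ P = 0 → ρ.im ≠ 0) → (∃ Q : Polynomial ℚ, ∀ ρ : ℂ, Polynomial.eval₂ (Int.castRingHom ℂ) ρ P = 0 → Polynomial.aeval ρ Q = (starRingEnd ℂ) ρ) → ∀ ⦃𝒳 S : Literature.AlgebraicGeometry.Motives.SchemeOver ℂ⦄ (f : 𝒳 ⟶ S), Literature.AlgebraicGeometry.Motives.IsSmoothProjectiveFamily f (4 * g) → IrreducibleSpace S.left → AlgebraicGeometry.Smooth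 S.hom → (∀ s : Literature.AlgebraicGeometry.Motives.ComplexPoints S, ∃ (A' : Literature.AlgebraicGeometry.Motives.AbelianVariety ℂ) (φ' : A' ⟶ A'), A'.dim = 4 * g ∧ Polynomial.eval₂ (Int.castRingHom (CategoryTheory.End A')) (φ' : CategoryTheory.End A') P = 0 ∧ Nonempty (A'.X ≅ Literature.AlgebraicGeometry.Motives.fiberOver f s)) → ∀ (W : Literature.AlgebraicGeometry.HodgeTheory.complexBetti 𝒳 4), (∀ s : Literature.AlgebraicGeometry.Motives.ComplexPoints S, Literature.AlgebraicGeometry.HodgeTheory.IsRationalClass (Literature.AlgebraicGeometry.HodgeTheory.complexBetti.map (Literature.AlgebraicGeometry.Motives.fiberι f s) 4 W) ∧ Literature.AlgebraicGeometry.HodgeTheory.IsOfHodgeType (4 * g) (Literature.AlgebraicGeometry.Motives.fiberOver f s) 4 2 2 (Literature.AlgebraicGeometry.HodgeTheory.complexBetti.map (Literature.AlgebraicGeometry.Motives.fiberι f s) 4 W)) → (∃ s₀ : Literature.AlgebraicGeometry.Motives.ComplexPoints S, Literature.AlgebraicGeometry.HodgeTheory.complexBetti.map (Literature.AlgebraicGeometry.Motives.fiberι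 f s₀) 4 W ∈ Literature.AlgebraicGeometry.HodgeTheory.algebraicClasses (Literature.AlgebraicGeometry.Motives.fiberOver f s₀) 2) → ∀ s : Literature.AlgebraicGeometry.Motives.ComplexPoints S, Literature.AlgebraicGeometry.HodgeTheory.complexBetti.map (Literature.AlgebraicGeometry.Motives.fiberι f s) 4 W ∈ Literature.AlgebraicGeometry.HodgeTheory.algebraicClasses (Literature.AlgebraicGeometry.Motives.fiberOver f s) 2

/-- item stmt-HodgeConjecture-16266 · crux · rank 3 · open · by planner
why it might fail: the typed transport wants ONE smooth irreducible base, smooth projective total space, fibres ≅ (A′, φ′) with P(φ′)=0 and a GLOBAL degree-4 class through face and anchor (neat level, det-1 cover, invariant cycles on a non-proper total space); h_cancel's θ-pairing must hit every σ-line.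
sources: Andre1992HodgeCM, CharlesSchnell2014Notes, Deligne1982HodgeCycles, MoonenZarhin1998WeilClasses, vanGeemen1994HodgeAV
[crux] rank-four transport already gives the whole CM sector: RankFourWeilTransport →
CMAbelianHodge. Proof plan (print + stockroom): (i) André's decomposition over a Galois CM field E ∋
√-d splitting A (CharlesSchnell2014Notes 11.5.21) writes every Hodge class on A ⊗_ℚ E ~ ∏ A_a^{m(a)}
as a sum of pull-backs of the E-lines L_m, m balanced; (ii) the 2001 lattice theorem (adapt
`reserve/prior-2001/Prior/HodgeConjecture/HodgeConjecture/Hodge_WSupersingularLiftingRankFourWeilGeneration_RankFourWeilLattice.lean`: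
`theoremA`, `exists_nonneg_decomposition`, `algebraic_of_faces`) reduces all L_m to pairs (Lefschetz
(1,1)) and faces, using exterior products (h_mul) and the cancellation L_{m+u}, L_u algebraic ⇒ L_m
algebraic (h_cancel: project (x ⊗ y) ∪ pr₂^*(ȳ θ^r) to A_m; the θ-power pairs each σ-line of L_u
non-trivially); (iii) faces are of split Weil type (11.5.22), so Deligne's family (11.5.24, neat
level, det-1 monodromy, global invariant cycles) joins each face to a Hecke translate of A₀ ⊗_ℚ E,
A₀ an abelian surface, where W_E = pull-backs of the point class of A₀ along homomorphisms A₀^{2g} →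
A₀ (Vandermonde/polarisation of the 4-form) is algebraic; (iv) RankFourWeilTransport carri -/
@[route_item "route-HodgeConjecture-RankFourFaces"]
def FaceReduction : Prop :=
  RankFourWeilTransport → CMAbelianHodge

/-- item stmt-HodgeConjecture-16267 · crux · rank 4 · open · by planner
why it might fail: needs variational Hodge in every codimension along Mumford–Tate families of abelian varieties — open beyond divisors; HC could fail at a Hodge-generic abelian variety while holding at all CM points (absoluteness cannot tell them apart).
sources: Deligne1982HodgeCycles, Andre1996Motifs, CharlesSchnell2014Notes, arXiv:2509.23403
[crux] the Hodge conjecture for CM abelian varieties implies the Hodge conjecture for every complex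
abelian variety: every (A, its Hodge classes) sits in its Mumford–Tate family, whose CM points are
dense (Deligne/André) and where the flat extensions of the Hodge classes of A stay Hodge; transport
algebraicity from a CM fibre (variational Hodge for abelian schemes, all codimensions — the abelian
instance of AnchorTransport.VariationalHodge with AnchorExistence discharged by CM density). [deps:
FaceReduction] [difficulty: open-problem] -/
@[route_item "route-HodgeConjecture-RankFourFaces"]
def CMToAbelian : Prop :=
  CMAbelianHodge → ∀ (A : Literature.AlgebraicGeometry.Motives.AbelianVariety ℂ), Literature.AlgebraicGeometry.Motives.IsSmoothProjective A.dim A.X → Literature.AlgebraicGeometry.HodgeTheory.HodgeConjectureFor A.dim A.X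

-- earlier AbelianComplement (stmt-HodgeConjecture-10452, replaced 2026-08-16T16:51:37Z -> stmt-HodgeConjecture-15889): open — (∀ A : Literature.AlgebraicGeometry.Motives.AbelianVariety ℂ, Literature.AlgebraicGeometry.Motives.IsSmoothProjective A.dim A.X → Literature.AlgebraicGeometry.HodgeTheory.HodgeConjectureFor A.dim A.X) → HodgeConjecture
/-- item stmt-HodgeConjecture-15889 · crux · rank 9 · open · by planner
why it might fail: it is HC for everything of non-abelian type (general hypersurfaces, Calabi–Yau, surfaces of general type): HC fails for Kähler manifolds (Voisin 2002) and integrally, so it may be false here, and the route's mechanism does not bear on it.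
sources: Voisin2002KaehlerCounterexample, Deligne2000, Andre1996Motifs, CharlesSchnell2014Notes
[crux] NOT THE ROUTE'S MECHANISM — the remainder of the summit, RESTATED 2026-08-16 (route-repair,
ground) in COMPLEMENT form: the Hodge conjecture `HodgeTheory.HodgeConjectureFor n X` for every
smooth projective complex n-fold X that is NOT the underlying variety A.X of an n-dimensional
complex abelian variety A (X carries no abelian-variety structure). Rev 0 used verbatim the
conditional shared decl `ConservativityLefschetz.AbelianComplement`, `(∀ A, IsSmoothProjective A.dim
A.X → HodgeConjectureFor A.dim A.X) → HodgeConjecture`; since FaceReduction := RankFourWeilTransport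
→ CMAbelianHodge and CMToAbelian := CMAbelianHodge → (HC for abelian varieties) are themselves
implications, that typing made the Assembly item a propositional tautology (ground battery:
ground.trivial tauto). Now the abelian locus is excluded in the hypothesis and the deciding theorem
`closes` does the case split (X = A.X with A.dim = n: CMToAbelian (FaceReduction
RankFourWeilTransport) A; otherwise this item) — the typing pattern of
PadicSemiregularLift.HodgeBeyondAnchors without its Fermat exclusion. The clause A.dim = n is
automatic for X smooth projective of dimension n (schemeDim of a smooth projective n -/
@[route_item "route-HodgeConjecture-RankFourFaces"]
def AbelianComplement : Prop :=
  ∀ ⦃n : ℕ⦄ ⦃X : Literature.AlgebraicGeometry.Motives.SchemeOver ℂ⦄, Literature.AlgebraicGeometry.Motives.IsSmoothProjective n X → (∀ A : Literature.AlgebraicGeometry.Motives.AbelianVariety ℂ, A.dim = n → A.X ≠ X) → Literature.AlgebraicGeometry.HodgeTheory.HodgeConjectureFor n X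

/-- item stmt-HodgeConjecture-16268 · support · rank 9 · open · by planner
sources: MoonenZarhin1998WeilClasses, arXiv:2509.23403, Markman2025SecantWeil, Weil1977HodgeRing
[support] the POINTWISE form the transport delivers on every split component and the tree's first
typed statement of "Weil classes for CM fields of degree > 2": for (A, φ) an abelian 4g-fold with
P(φ) = 0 (P as in crux 2, E = ℚ[T]/(P) CM of degree 2g ≥ 4, E-rank 4), every rational (2,2)-class in
the complexified E-Weil space (⋀⁴_E H¹(A,ℚ)) ⊗ ℂ = ⨆_{P(ρ)=0} {c : (x·𝟙 + y·φ)^*c = (x + yρ)⁴ c ∀ x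
y ∈ ℕ} (Moonen–Zarhin W_E with r = 4, on the tree's `pullbackEigenclasses` carrier) is algebraic.
For E imaginary quadratic (excluded: g ≥ 2) it is Markman's fourfold theorem; stated for all
discriminant classes (implied by HC; for non-split classes no anchor is known and the reduction does
not need them). A refutation refutes CMAbelianHodge at a face, or HC off the CM points. [difficulty:
open-problem] -/
@[route_item "route-HodgeConjecture-RankFourFaces"]
def RankFourWeilClasses : Prop :=
  ∀ (g : ℕ), 2 ≤ g → ∀ (P : Polynomial ℤ), P.Monic → P.natDegree = 2 * g → Irreducible (P.map (Int.castRingHom ℚ)) → (∀ ρ : ℂ, Polynomial.eval₂ (Int.castRingHom ℂ) ρ P = 0 → ρ.im ≠ 0) → (∃ Q : Polynomial ℚ, ∀ ρ : ℂ, Polynomial.eval₂ (Int.castRingHom ℂ) ρ P = 0 → Polynomial.aeval ρ Q = (starRingEnd ℂ) ρ) → ∀ (A : Literature.AlgebraicGeometry.Motives.AbelianVariety ℂ) (φ : A ⟶ A), A.dim = 4 * g → Literature.AlgebraicGeometry.Motives.IsSmoothProjective (4 * g) A.X → Polynomial.eval₂ (Int.castRingHom (CategoryTheory.End A)) (φ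 : CategoryTheory.End A) P = 0 → ∀ c : Literature.AlgebraicGeometry.HodgeTheory.complexBetti A.X 4, Literature.AlgebraicGeometry.HodgeTheory.IsRationalClass c → Literature.AlgebraicGeometry.HodgeTheory.IsOfHodgeType (4 * g) A.X 4 2 2 c → c ∈ (⨆ ρ ∈ {ρ : ℂ | Polynomial.eval₂ (Int.castRingHom ℂ) ρ P = 0}, Literature.AlgebraicGeometry.HodgeTheory.pullbackEigenclasses A φ 4 (fun x y => ((x : ℂ) + (y : ℂ) * ρ) ^ 4)) → c ∈ Literature.AlgebraicGeometry.HodgeTheory.algebraicClasses A.X 2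

/-- item stmt-HodgeConjecture-16269 · assembly · rank 1 · closed · proved by Summit.HodgeConjecture.HodgeConjecture.Theorems.rankFourFaces_assembly_proof @ 56db29b4b4db (prover) · by planner
sources: Andre1992HodgeCM, CharlesSchnell2014Notes
[assembly] RankFourWeilTransport → FaceReduction → CMToAbelian → AbelianComplement →
HodgeConjecture. -/
@[route_item "route-HodgeConjecture-RankFourFaces"]
def Assembly : Prop :=
  RankFourWeilTransport → FaceReduction → CMToAbelian → AbelianComplement → HodgeConjecture

/-! D-0027 §2.1 — DECIDING THEOREM (planner-authored via `route open/edit --closes-file`; by planner-rground-HodgeConjecture-RankFourFaces-3a855859-0 2026-08-16T16:52:16Z):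
its hypotheses are this route's items and its conclusion the sub-problem Statement (glue_lint), and it elaborates with this file. -/

@[closes "route-HodgeConjecture-RankFourFaces"] theorem closes (h₂ : RankFourWeilTransport) (h₃ : FaceReduction) (h₄ : CMToAbelian)
    (h₉ : AbelianComplement) : _root_.HodgeConjecture := by
  intro n X hX
  by_cases hAb : ∃ A : Literature.AlgebraicGeometry.Motives.AbelianVariety ℂ, A.dim = n ∧ A.X = X
  · obtain ⟨A, rfl, rfl⟩ := hAb
    exact h₄ (h₃ h₂) A hX
  · exact h₉ hX fun A hA hAX => hAb ⟨A, hA, hAX⟩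

end Summit.HodgeConjecture.HodgeConjecture.Theses.RankFourFaces
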